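import Summits.CriticalPhenomena.PercolationContinuityZ3.Theorems.Transplant.PlanarSkeletonFrmQuasiDefs
import Summits.CriticalPhenomena.PercolationContinuityZ3.Theorems.Transplant.SkelFrmQuasiBParamsFaceFloorsHypsF
import Summits.CriticalPhenomena.PercolationContinuityZ3.Theorems.Transplant.SkelFrmBParamsFaceFloorsHypsF
import Summits.CriticalPhenomena.PercolationContinuityZ3.Theorems.Transplant.SkelFrmQuasiBParamsFaceFloorsY2WC
import Summits.CriticalPhenomena.PercolationContinuityZ3.Theorems.Transplant.SkelFrmBParamsFaceFloorsY2WC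
import Summits.CriticalPhenomena.PercolationContinuityZ3.Theorems.Transplant.SkelFrmQuasiBParamsFaceOriginsYQA
import Summits.CriticalPhenomena.PercolationContinuityZ3.Theorems.Transplant.SkelFrmBParamsFaceOriginsYQA
import Summits.CriticalPhenomena.PercolationContinuityZ3.Theorems.Transplant.SkelPhiFaceNumsYP2V
import Summits.CriticalPhenomena.PercolationContinuityZ3.Theorems.Transplant.SkelFrmQuasi1SlotTypes
import HarnessLib
import Summits.CriticalPhenomena.PercolationContinuityZ3.Theorems.Transplant.SkelFrmBParamsFaceFloorsYY2HFW
/-!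
# GEN-Q PORT (WAVE-Q table v0.8 section 2, row G227, U-level L25; captain R-6/R-7 2026-08-27: carrier token swap `PlanarSkeletonFrmFrom ↦ PlanarSkeletonFrmQuasi`)
# of the tree module «Transplant/SkelFrmFromBParamsFaceFloorsYY2HFW» (sha256 1d89239fde3df81c…) onto the quasi-step carrier `PlanarSkeletonFrmQuasi` (p507026): «SkelFrmQuasiBParamsFaceFloorsYY2HFW»

HAND HUNK (L-FLOORMAP-1 ①⑥ / L-KitS-1 reader side; G017 «SkelFrmQuasiBChoiceNums», hp-8's KitSN): R'0×3, Rlev0×4, reach0×4 — the (S0) kit of record at window cost `KS.NQ Φ`.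

ORIGINAL TITLE: N2 (frames-only node, OPEN) — (F) column under (R-44)(c)/(R-48), DISCHARGE LAYER: **THE ONE-SIDED y′-FACE FLOORS IN THE V PROVIDER's PREMISE SHAPE**

builds on p205010 (kernel theorem, internal audit signed; external expert review pending) — nothing in this file uses p205010; NOTHING is claimed about any open node
((N3-b), the end state).  Lane `prim-bschramm`, seat `prim-bschramm-stmt` (gen 33; GEN-Q column pen; tool = captain gen-1 g4's port_genq.py R-14 --cone + p3-g30's T1 patch).  Helper file (`--supports stmt-CriticalPhenomena-4575 --as helper`).
PORT RULES (U-wave r1–r4 re-used, GEN-Q hunk classes of p3-g29 #6136): declaration order, names and proof texts are those of «SkelFrmFromBParamsFaceFloorsYY2HFW», byte-identical except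
(i) the carrier token `PlanarSkeletonFrmFrom ↦ PlanarSkeletonFrmQuasi` in binders, `namespace`/`end` lines and qualified names (module names `SkelFrmFrom… ↦ SkelFrmQuasi…`
in imports of already-ported rows); (ii) `Φ.step ↦ Φ.qstep` with the called Steps lemma replaced by its `…Q`/`_q` twin and the cost `Φ.M` threaded (none in this file unless
listed below); (iii) `Φ.cyl_connected ↦ Φ.cyl_reach` readers (none unless listed); (iv) graph-ball radii / window floors ×`Φ.M` (none unless listed).  Carrier-free
residents stay imported/exported from the original «SkelFrmBParamsFaceFloorsYY2HFW» exactly as in the FrmFrom port.  Docstrings and citations are the original's.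

-/

noncomputable section

open scoped Classical

namespace Summit.CriticalPhenomena.PercolationContinuityZ3.Theorems.Transplant

namespace PlanarSkeletonFrmQuasi

namespace NegB

namespace KS

open Literature.Probability.Percolation Literature.Probability.LatticeModels SimpleGraph
open Literature.Probability.Percolation.KozmaNitzan.Cells (oth sgOf sgOf_sign)
open SkelConc (Consts)
open Skelφ.StepI (DataNS)
open TwoAxis.Para (modulus)
open Neg

/-- **The forward-start premise from DESIGN W's shifted reading** (y′-face, onward step): `|z₀ − (cenS x₀ + faceSh du)| ≤ kE`, `du.2 = true` and the row
`2·kE + hF₁ − hB₁ + 14·u₀ ≤ 2·(c₁ + bw)` give `7·u₀ ≤ T0Y P.toPCells2T x du z + bw` (and `|z₀ − cenS x₀| ≤ kE + r₀`). [this work] -/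
theorem hTw_of_shiftedY (κ : Consts) {V : Type} [DecidableEq V] [Countable V] {G : SimpleGraph V} [G.LocallyFinite] (Φ : PlanarSkeletonFrmQuasi G) (t : V) (p : unitInterval) (D : Skelφ.StepI.DataNS V) (g f : ℕ)
    (P : PCells2V) (x : Site 2) (du : MDir) (hd : du.1 = 1) (hs : du.2 = true) (z : Site 2) {kE : ℤ} {bw : ℕ}
    (hzW : |z 0 - (P.cenS x 0 + P.faceSh du)| ≤ kE)
    (hfwd : 2 * kE + (P.hF 1 : ℤ) - P.hB 1 + 14 * u₀A κ Φ t p D g f ≤ 2 * ((P.c 1 : ℤ) + bw)) :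
    7 * u₀A κ Φ t p D g f ≤ T0Y P.toPCells2T x du z + bw ∧ |z 0 - P.cenS x 0| ≤ kE + (P.r 0 : ℤ) := by
  have hsg : sgOf du = 1 := by unfold sgOf; rw [hs]; rfl
  have hsh := P.abs_faceSh_le du
  rw [hd, show oth (1 : Fin 2) = 0 from rfl] at hsh
  obtain ⟨s1, s2⟩ := abs_le.1 hsh
  obtain ⟨w1, w2⟩ := abs_le.1 hzW
  have e : T0Y P.toPCells2T x du z = -(z 0 - P.cenS x 0) + sgOf du * (P.c 1 : ℤ) := by
    unfold T0Y; rw [cenS_step_zero P.toPCells2T x du hd]; ring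
  have hfs : P.faceSh du = ((P.hF 1 : ℤ) - P.hB 1) / 2 := by unfold PCells2V.faceSh; rw [hsg, hd, one_mul]
  refine ⟨?_, abs_le.2 ⟨by linarith, by linarith⟩⟩
  rw [e, hsg, one_mul]
  rw [hfs] at w2
  have hdiv : 2 * (((P.hF 1 : ℤ) - P.hB 1) / 2) ≤ (P.hF 1 : ℤ) - P.hB 1 := Int.mul_ediv_self_le (by norm_num)
  linarith

set_option maxHeartbeats 1600000 in
/-- **THE ONE-SIDED y′-FACE FLOORS IN THE V PROVIDER's PREMISE SHAPE**, hop side `1` (see the module docstring). [cite: KozmaNitzan2024, §4 Lemma 11–12 (pp. 21–25)] -/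
theorem floorsY_YFs_FW (κ : Consts) {V : Type} [DecidableEq V] [Countable V] {G : SimpleGraph V} [G.LocallyFinite] (Φ : PlanarSkeletonFrmQuasi G) (t : V) (p : unitInterval) (D : Skelφ.StepI.DataNS V) (c mk : ℕ) (gx fx : Neg.FSlot)
    (hgx : ∀ D : DataNS V, gxFc mk c κ Φ t p D ≤ gx κ Φ t p D) (hfx : ∀ D : DataNS V, fxFc mk κ Φ t p D ≤ fx κ Φ t p D)
    (hN : EqNumL κ Φ t p D (gT mk gx κ Φ t p D) (fT mk fx κ Φ t p D)) (hκ : (hL κ Φ t p D (gT mk gx κ Φ t p D) (fT mk fx κ Φ t p D)).natAbs ≤ 10 * nL κ Φ t p D (gT mk gx κ Φ t p D) (fT mk fx κ Φ t p D))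
    (P : PCells2V) (hP : P.toPCells2 = fcellsA κ Φ t p D (gT mk gx κ Φ t p D) (fT mk fx κ Φ t p D)) {kE : ℤ}
    (hkE : kE + (P.r 0 : ℤ) ≤ 5 * (P.r 0 : ℤ))
    (hkE8 : kE + (P.r 0 : ℤ) + 8 * u₀A κ Φ t p D (gT mk gx κ Φ t p D) (fT mk fx κ Φ t p D) + 8 + P.c 1 ≤ 5 * (P.r 0 : ℤ))
    (hkE24 : 2 * (kE + (P.r 0 : ℤ)) + 24 * u₀A κ Φ t p D (gT mk gx κ Φ t p D) (fT mk fx κ Φ t p D) + 24 + 2 * (P.c 1 : ℤ) ≤ 5 * (P.r 0 : ℤ))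
    (hfwd : 2 * kE + (P.hF 1 : ℤ) - P.hB 1 + 14 * u₀A κ Φ t p D (gT mk gx κ Φ t p D) (fT mk fx κ Φ t p D) ≤ 2 * ((P.c 1 : ℤ) + (bwY κ Φ t p D (gT mk gx κ Φ t p D) (fT mk fx κ Φ t p D))))
    (hv0 : 0 ≤ vL κ Φ t p D (gT mk gx κ Φ t p D) (fT mk fx κ Φ t p D)) (hc : 600 * Neg.Kq κ ≤ c)
    (r : ℕ) (hr : πBudY κ Φ t p D c mk (gT mk gx κ Φ t p D) (fT mk fx κ Φ t p D) ≤ r) :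
    ∀ (x : Site 2) (du : MDir) (j : ℕ) (z : Site 2), du.1 = 1 → du.2 = true → j < P.K →
      P.faceL du.1 j - (((KS0.Rlev0N κ Φ (KS.NQ Φ) t p D mk + KS0.reach0N (KS.NQ Φ) t D mk) : ℕ) : ℤ) ≤ P.lev du x z → P.lev du x z ≤ P.faceL du.1 j + (((KS0.Rlev0N κ Φ (KS.NQ Φ) t p D mk + KS0.reach0N (KS.NQ Φ) t D mk) : ℕ) : ℤ) →
      |z (oth du.1) - (P.cenS x (oth du.1) + P.faceSh du)| ≤ kE →
      Skelφ.FloorsY2V (prFA κ Φ t p D (gT mk gx κ Φ t p D) (fT mk fx κ Φ t p D)) (nL κ Φ t p D (gT mk gx κ Φ t p D) (fT mk fx κ Φ t p D)) (u₀A κ Φ t p D (gT mk gx κ Φ t p D) (fT mk fx κ Φ t p D)) (u₁A κ Φ t p D (gT mk gx κ Φ t p D) (fT mk fx κ Φ t p D))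
      (modulus (nL κ Φ t p D (gT mk gx κ Φ t p D) (fT mk fx κ Φ t p D)) (hL κ Φ t p D (gT mk gx κ Φ t p D) (fT mk fx κ Φ t p D)) (vL κ Φ t p D (gT mk gx κ Φ t p D) (fT mk fx κ Φ t p D)) (vβL κ Φ t p D (gT mk gx κ Φ t p D) (fT mk fx κ Φ t p D))) (nL κ Φ t p D (gT mk gx κ Φ t p D) (fT mk fx κ Φ t p D) : ℤ) (ℓL κ Φ t p D (gT mk gx κ Φ t p D) (fT mk fx κ Φ t p D))
      P (NegB.BSlot.small3 κ Φ t p D (gT mk gx κ Φ t p D) (fT mk fx κ Φ t p D)) x du j 3 r (Mu D) z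
      (fun i => if i = 0 then kF₀A κ Φ t p D c mk (gT mk gx κ Φ t p D) (fT mk fx κ Φ t p D) else kF₁A κ Φ t p D c mk (gT mk gx κ Φ t p D) (fT mk fx κ Φ t p D))
      1 (BFs κ Φ t p D c mk (gT mk gx κ Φ t p D) (fT mk fx κ Φ t p D) 1) (KS0.R'0N κ Φ (KS.NQ Φ) t p D mk) (qBF κ Φ t p D c mk (gT mk gx κ Φ t p D) (fT mk fx κ Φ t p D)) (KS0.R'0N κ Φ (KS.NQ Φ) t p D mk) (qB3YA κ Φ t p D (gT mk gx κ Φ t p D) (fT mk fx κ Φ t p D) (KS0.R'0N κ Φ (KS.NQ Φ) t p D mk))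
      (yLFs κ Φ t p D c mk (gT mk gx κ Φ t p D) (fT mk fx κ Φ t p D) (sgOf du) 1) (NrY κ Φ t p D (gT mk gx κ Φ t p D) (fT mk fx κ Φ t p D) P.toPCells2T (yLFs κ Φ t p D c mk (gT mk gx κ Φ t p D) (fT mk fx κ Φ t p D) (sgOf du) 1) x du z) (N3WY κ Φ t p D (gT mk gx κ Φ t p D) (fT mk fx κ Φ t p D) P.toPCells2T ((yLFs κ Φ t p D c mk (gT mk gx κ Φ t p D) (fT mk fx κ Φ t p D) (sgOf du) 1) + Skelφ.crossOffY (nL κ Φ t p D (gT mk gx κ Φ t p D) (fT mk fx κ Φ t p D)) (ℓL κ Φ t p D (gT mk gx κ Φ t p D) (fT mk fx κ Φ t p D)) (hL κ Φ t p D (gT mk gx κ Φ t p D) (fT mk fx κ Φ t p D)) (vL κ Φ t p D (gT mk gx κ Φ t p D) (fT mk fx κ Φ t p D)) (sgOf du) (NrY κ Φ t p D (gT mk gx κ Φ t p D) (fT mk fx κ Φ t p D) P.toPCells2T (yLFs κ Φ t p D c mk (gT mk gx κ Φ t p D) (fT mk fx κ Φ t p D) (sgOf du) 1) x du z)) x du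 z (bwY κ Φ t p D (gT mk gx κ Φ t p D) (fT mk fx κ Φ t p D))) 1 := by
  intro x du j z hd hs hj hlev1 hlev2 hzW
  obtain ⟨hnA, hnA24, hℓA, hS, hS64, hMR0, hMR0K, hRn0⟩ := slotsF_hyps κ Φ t p D c mk gx fx hgx hfx hN
  obtain ⟨hs0, hs1, hu2, hkF0, hkF1⟩ := cellsF_hyps κ Φ t p D c mk gx fx hgx hN hκ
  obtain ⟨hE2, -, -, hEu1⟩ := bandF_facts κ Φ t p D c mk gx fx hgx hN hκ
  have hσ : sgOf du = 1 ∨ sgOf du = -1 := sgOf_sign du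
  have hsg : sgOf du = 1 := by unfold sgOf; rw [hs]; rfl
  have hσh : (1 : ℤ) = 1 ∨ (1 : ℤ) = -1 := Or.inl rfl
  have hhopLo : sgOf du * 1 = 1 → 0 ≤ vL κ Φ t p D (gT mk gx κ Φ t p D) (fT mk fx κ Φ t p D) := fun _ => hv0
  have hhopHi : sgOf du * 1 = -1 → vL κ Φ t p D (gT mk gx κ Φ t p D) (fT mk fx κ Φ t p D) ≤ 0 := fun h => by rw [hsg] at h; norm_num at h
  rw [hd, show oth (1 : Fin 2) = 0 from rfl] at hzW
  have hd' : du.1 = 1 := hd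
  have hP' : P.toPCells2T.toPCells2 = fcellsA κ Φ t p D (gT mk gx κ Φ t p D) (fT mk fx κ Φ t p D) := hP
  obtain ⟨hTw, hz'⟩ := hTw_of_shiftedY κ Φ t p D (gT mk gx κ Φ t p D) (fT mk fx κ Φ t p D) P x du hd' hs z hzW hfwd
  have hlev1' : (P.toPCells2T.faceL 1 j : ℤ) - (((KS0.Rlev0N κ Φ (KS.NQ Φ) t p D mk + KS0.reach0N (KS.NQ Φ) t D mk) : ℕ) : ℤ) ≤ P.toPCells2T.lev du x z := by rw [hd] at hlev1; exact hlev1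
  have hlev2' : P.toPCells2T.lev du x z ≤ P.toPCells2T.faceL 1 j + (((KS0.Rlev0N κ Φ (KS.NQ Φ) t p D mk + KS0.reach0N (KS.NQ Φ) t D mk) : ℕ) : ℤ) := by rw [hd] at hlev2; exact hlev2
  -- the bridge-offset index: `NrY + 1 ≤ 600·Kq ≤ c` at the origin `yLFs … 1`
  obtain ⟨-, he1, -⟩ := he_yLFs κ Φ t p D c mk gx (fT mk fx κ Φ t p D) hN hκ hS hMR0 hσ hσh
  have hu1 : 1 ≤ u₁A κ Φ t p D (gT mk gx κ Φ t p D) (fT mk fx κ Φ t p D) := (units_eqA κ Φ t p D (gT mk gx κ Φ t p D) (fT mk fx κ Φ t p D)).2.2.2.2.2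
  have hNr := (NrY_range κ Φ t p D (gT mk gx κ Φ t p D) (fT mk fx κ Φ t p D) P.toPCells2T hP' x du hd' z hj hlev1' hlev2' (yLFs κ Φ t p D c mk (gT mk gx κ Φ t p D) (fT mk fx κ Φ t p D) (sgOf du) 1) he1 (by have h' := hEu1; push_cast at h' ⊢; linarith)).2
  exact Skelφ.FloorsY2V.ofT (floorsY2_YFsW κ Φ t p D c mk gx fx P.toPCells2T hP' hN hκ hnA hℓA hS hS64 hMR0 hRn0 hs0 hs1 hkF0 hkF1 x du hd' j hj z hlev1' hlev2' hz' hEu1 hE2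
    hkE hkE8 hkE24 hTw 1 hσh hhopLo hhopHi (hNr.trans hc) r hr)

end KS

end NegB

end PlanarSkeletonFrmQuasi

end Summit.CriticalPhenomena.PercolationContinuityZ3.Theorems.Transplant

end
-- build-touch 2026-08-25T15:40Z T1-D (lead g18): re-land of p397931, declarations byte-identical
-- build-touch 2026-08-25T18:53Z T1-D (lead g18) 2nd touch (90-min clause): re-land of p401675, declarations byte-identical
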